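import Summits.ResolutionOfSingularities.ResolutionOfSingularities.Theorems.FrobeniusLadderFRationalResolutionFaceRank
import Literature.AlgebraicGeometry.Resolution.LogRegularResolution
import Mathlib.RingTheory.GradedAlgebra.Basic
import Mathlib.Algebra.Order.Monoid.Submonoid
import HarnessLib

/-!
# Crux `FrobeniusLadder.FRationalResolution` (stmt-ResolutionOfSingularities-15317), line `redirect`,
# stub `stub_diagonalizableQuotientResolution` — the FACE of the fixed-point monomial chart at an
# arbitrary prime, and its rank (item (C2) of the packaging step, memo MEMO-15317-leafhand2-g3 §8)

For the chart `φ : P → S₀`, `P = {m ∈ ℕⁿ : Σ mᵢ aᵢ = 0}` (as `AddSubmonoid.nonneg ⊓ mker`),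
`φ(m) = x^m`, and a prime `𝔮' = 𝔔' ∩ S₀` (`𝔔'` a prime of `S`): the face `{m ∈ P : φ(m) ∉ 𝔮'}`
(`LogChart.face`) is `{m ∈ P : mᵢ = 0 whenever xᵢ ∈ 𝔔'}` (primality of `𝔔'`), so by
`…FaceRank.finrank_span_face_eq_card` its `ℤ`-span has rank `#{j : x_j ∉ 𝔔'}` — Kato's rank term
`n − rk` is `#{i : xᵢ ∈ 𝔔'}`.

* `prod_pow_not_mem_iff` — `∏ xᵢ^{mᵢ} ∉ 𝔔' ↔ ∀ i, mᵢ ≠ 0 → xᵢ ∉ 𝔔'`;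
* **`image_face_eq`** — the face as the explicit set;
* **`finrank_span_face_chart`** — `finrank ℤ (span (face)) = |J|` for any `J` listing `{j | x_j ∉ 𝔔'}`.

Honest label: chart bookkeeping (no stub closed). No definitions, no named facts, no sorry.
[folklore; cite: Kato1994, Def. (2.1)]
-/

noncomputable section

-- single-problem summit: the doubled namespace component is forced
set_option linter.dupNamespace false

open Literature.AlgebraicGeometry.Resolution

namespace Summit.ResolutionOfSingularities.ResolutionOfSingularities.Theorems.FRationalResolution.ChartFace

universe u w

/-- In a prime ideal, a product of powers lies outside iff every factor with positive exponent does.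
[folklore] -/
theorem prod_pow_not_mem_iff {S : Type u} [CommRing S] (𝔔 : Ideal S) [𝔔.IsPrime] {n : ℕ}
    (x : Fin n → S) (m : Fin n → ℕ) :
    ∏ i, x i ^ m i ∉ 𝔔 ↔ ∀ i, m i ≠ 0 → x i ∉ 𝔔 := by
  classical
  rw [Ideal.IsPrime.prod_mem_iff]
  push Not
  refine ⟨fun h i hmi hxi => h i (Finset.mem_univ i) (𝔔.pow_mem_of_mem hxi _ (Nat.pos_of_ne_zero hmi)),
    fun h i _ hxm => ?_⟩
  by_cases hmi : m i = 0
  · rw [hmi, pow_zero] at hxm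
    exact ‹𝔔.IsPrime›.ne_top ((Ideal.eq_top_iff_one _).mpr hxm)
  · exact h i hmi (‹𝔔.IsPrime›.mem_of_pow_mem _ hxm)

variable {k : Type u} [Field k] {A : Type w} [DecidableEq A] [AddCommGroup A] {S : Type u}
  [CommRing S] [Algebra k S] (𝒮 : A → Submodule k S) [GradedAlgebra 𝒮]
  {n : ℕ} (x : Fin n → S) (a : Fin n → A)

/-- **The face of the monomial chart at `𝔮' = 𝔔' ∩ S₀`, explicitly.** For the chart
`φ : P → S₀` with `φ(m) = ∏ xᵢ^{mᵢ}` on `P = ℕⁿ ∩ ker(m ↦ Σ mᵢaᵢ)`, the face at `𝔔' ∩ S₀` consists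
of the `m ∈ P` vanishing at every `i` with `xᵢ ∈ 𝔔'`. [folklore; cite: Kato1994, Def. (2.1)] -/
theorem image_face_eq
    (φ : Multiplicative ↥(AddSubmonoid.nonneg (Fin n → ℤ) ⊓
        AddMonoidHom.mker (Fintype.linearCombination ℤ a).toAddMonoidHom) →* 𝒮 0)
    (hφ : ∀ p, ((φ (Multiplicative.ofAdd p) : 𝒮 0) : S) = ∏ i, x i ^ ((p : Fin n → ℤ) i).toNat)
    (𝔔' : Ideal S) [𝔔'.IsPrime] :
    (fun p : ↥(AddSubmonoid.nonneg (Fin n → ℤ) ⊓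
        AddMonoidHom.mker (Fintype.linearCombination ℤ a).toAddMonoidHom) => (p : Fin n → ℤ)) ''
      LogChart.face _ φ (𝔔'.comap (algebraMap (𝒮 0) S)) =
    {v : Fin n → ℤ | 0 ≤ v ∧ Fintype.linearCombination ℤ a v = 0 ∧
      ∀ i, x i ∈ 𝔔' → v i = 0} := by
  classical
  ext v
  simp only [Set.mem_image, LogChart.mem_face_iff, Set.mem_setOf_eq]
  constructor
  · rintro ⟨p, hp, rfl⟩
    have hnn : (0 : Fin n → ℤ) ≤ (p : Fin n → ℤ) :=
      AddSubmonoid.mem_nonneg.mp (AddSubmonoid.mem_inf.mp p.2).1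
    have hdeg : Fintype.linearCombination ℤ a (p : Fin n → ℤ) = 0 :=
      (AddMonoidHom.mem_mker).mp (AddSubmonoid.mem_inf.mp p.2).2
    refine ⟨hnn, hdeg, fun i hxi => ?_⟩
    rw [Ideal.mem_comap, show algebraMap (𝒮 0) S (φ (Multiplicative.ofAdd p)) =
      ((φ (Multiplicative.ofAdd p) : 𝒮 0) : S) from rfl, hφ] at hp
    have h := (prod_pow_not_mem_iff 𝔔' x _).mp hp i
    by_contra hne
    have hpos : 0 < (p : Fin n → ℤ) i := lt_of_le_of_ne (hnn i) (Ne.symm hne)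
    exact h (by omega) hxi
  · rintro ⟨hnn, hdeg, hzero⟩
    refine ⟨⟨v, AddSubmonoid.mem_inf.mpr ⟨AddSubmonoid.mem_nonneg.mpr hnn,
      AddMonoidHom.mem_mker.mpr (show (Fintype.linearCombination ℤ a).toAddMonoidHom v = 0 from
        hdeg)⟩⟩, ?_, rfl⟩
    rw [Ideal.mem_comap, show algebraMap (𝒮 0) S (φ (Multiplicative.ofAdd _)) =
      ((φ (Multiplicative.ofAdd _) : 𝒮 0) : S) from rfl, hφ]
    refine (prod_pow_not_mem_iff 𝔔' x _).mpr fun i hmi hxi => hmi ?_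
    have h0 : v i = 0 := hzero i hxi
    change (v i).toNat = 0
    rw [h0, Int.toNat_zero]

/-- **The rank of the face of the monomial chart** at `𝔔' ∩ S₀` is the number of parameters outside
`𝔔'` (all `aᵢ` of finite order). [folklore; cite: Kato1994, Def. (2.1)] -/
theorem finrank_span_face_chart (ha : ∀ i, IsOfFinAddOrder (a i))
    (φ : Multiplicative ↥(AddSubmonoid.nonneg (Fin n → ℤ) ⊓
        AddMonoidHom.mker (Fintype.linearCombination ℤ a).toAddMonoidHom) →* 𝒮 0)
    (hφ : ∀ p, ((φ (Multiplicative.ofAdd p) : 𝒮 0) : S) = ∏ i, x i ^ ((p : Fin n → ℤ) i).toNat)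
    (𝔔' : Ideal S) [𝔔'.IsPrime] (J : Finset (Fin n)) (hJ : ∀ i, i ∈ J ↔ x i ∉ 𝔔') :
    Module.finrank ℤ (Submodule.span ℤ ((fun p : ↥(AddSubmonoid.nonneg (Fin n → ℤ) ⊓
        AddMonoidHom.mker (Fintype.linearCombination ℤ a).toAddMonoidHom) => (p : Fin n → ℤ)) ''
      LogChart.face _ φ (𝔔'.comap (algebraMap (𝒮 0) S)))) = J.card := by
  classical
  rw [image_face_eq 𝒮 x a φ hφ 𝔔']
  have hset : {v : Fin n → ℤ | 0 ≤ v ∧ Fintype.linearCombination ℤ a v = 0 ∧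
      ∀ i, x i ∈ 𝔔' → v i = 0} =
      {v : Fin n → ℤ | 0 ≤ v ∧ Fintype.linearCombination ℤ a v = 0 ∧ ∀ i ∉ J, v i = 0} := by
    ext v
    simp only [Set.mem_setOf_eq]
    refine and_congr_right fun _ => and_congr_right fun _ => ?_
    refine forall_congr' fun i => ?_
    rw [hJ, not_not]
  rw [hset]
  exact FaceRank.finrank_span_face_eq_card a ha J

end Summit.ResolutionOfSingularities.ResolutionOfSingularities.Theorems.FRationalResolution.ChartFace

end
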